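import Summits.ValiantsHypothesis.ValiantsHypothesis.Theorems.NewtonUnitEquationsTwoProductsTowerRecordDefs

/-!
# val-idea-34 g9 — typed text of the TWO-DIRECTION (bi-tower) record / carrier statements (R13²-box), scratch only

Ideation seat val-idea-34 g9 (lens (c)), crux `stmt-ValiantsHypothesis-5906` (`…Theses.NewtonUnitEquations.TwoProducts`).
NOT a card, NOT a proposal: a typed offer to val-idea-crit-8 / val-lit-p3 / val-idea-37 (bus note 2026-08-29), should the critic
want the TWOSHIFT-grid regime (val-neg-1 g7 j320789) moved from «not covered» to «covered with a box factor».

MODEL.  Letters `x_i + e₁•d₁ + e₂•d₂` (`0 ≤ e_c ≤ L_c`) — a BI-TOWER with box `(L₁, L₂)` along two directions `d₁, d₂ ∈ ℤ²` on each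
carrier `x_i`; letter pencils `γ_{j i} ∈ ℂ[z₁,z₂]` of bidegree `≤ (L₁,L₂)`; `M(S) = Σ_j Π_i γ_{j i}^{S_i}`, layer `L_k(S) = [z^k](M_γ(S) − M_γ'(S))`,
`k ∈ ℕ²`; the pair `(S,k)` sits at `S•x + k₁•d₁ + k₂•d₂`.  `L₂ = 0` is R13's tower model (`TowerRecord.*`).

CLAIMED (paper proof in the g9 note, NOT kernel-checked): `BiTowerRecordLaw` with `(a,b) ≈ (20,2)`: K2 (record lemma) verbatim with
`deg/ord ↦ w-top`, `w = (ξ•d₁, ξ•d₂)`; K1 (≤ 2m record carriers per cell) by the bivariate Siegel count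
`(2m+1)(A₁+1)(A₂+1) > 2m(A₁+L₁+1)(A₂+L₂+1)` at `A_c = 8mL_c − 1`; the 2-D comparison arrangement
`{ξ•(x_a − x_b + j₁d₁ + j₂d₂) = 0, |j_c| ≤ A_c} ∪ {ξ•(j₁d₁+j₂d₂) = 0}` fixes the `w`-order on box exponents AND on layers (`mL_c ≤ A_c`),
so each open cell carries ≤ 2m record carriers and exactly one record layer per candidate multiset; records are unique per weight, so
boundary rays carry ≤ 1 each.  HONEST SIZE: content only at MANY carriers (at `n = 1` the bound is weaker than Jarník's `O((mL)^{2/3})`);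
the HEIGHT-FREE 2-D analogue at `n = 1` is `PlanarCellBound` on size-separated cells (val-lit-p3 g18 00:23:17Z, val-idea-37 g4 §10.6) and
is NOT claimed.  `ResidualLawV24`, `PlanarCellBound`, the crux and every summit statement are untouched; VP ≠ VNP is NOT proved.
-/

set_option linter.dupNamespace false

noncomputable section

open Classical

namespace ValIdea34g9

open scoped BigOperators
open Summit.ValiantsHypothesis.ValiantsHypothesis.Theorems.NewtonUnitEquations.TwoProducts.FormalLogLinearisation
open Summit.ValiantsHypothesis.ValiantsHypothesis.Theorems.NewtonUnitEquations.TwoProducts.MomentRecord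
open Summit.ValiantsHypothesis.ValiantsHypothesis.Theorems.NewtonUnitEquations.TwoProducts.PlanarCell
open Summit.ValiantsHypothesis.ValiantsHypothesis.Theorems.NewtonUnitEquations.TwoProducts.TowerRecord

variable {m n : ℕ}

/-- The layer index `k = (k₁,k₂)` as a monomial exponent of `ℂ[z₁,z₂]`. -/
def mono2 (k : ℕ × ℕ) : Fin 2 →₀ ℕ := Finsupp.single 0 k.1 + Finsupp.single 1 k.2

/-- Bi-tower moment polynomial `Σ_j Π_i γ_{j i}^{S_i} ∈ ℂ[z₁,z₂]`. -/
def momentPoly2 (γ : Fin m → Fin n → MvPolynomial (Fin 2) ℂ) (S : Fin n → ℕ) : MvPolynomial (Fin 2) ℂ :=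
  ∑ j, ∏ i, γ j i ^ S i

/-- Layer `k` of the signed bi-tower moment polynomial. -/
def layer2 (γ γ' : Fin m → Fin n → MvPolynomial (Fin 2) ℂ) (k : ℕ × ℕ) (S : Fin n → ℕ) : ℂ :=
  MvPolynomial.coeff (mono2 k) (momentPoly2 γ S - momentPoly2 γ' S)

/-- All pencils have bidegree `≤ (L₁, L₂)`. -/
def BidegLe (γ : Fin m → Fin n → MvPolynomial (Fin 2) ℂ) (L₁ L₂ : ℕ) : Prop :=
  ∀ j i, ∀ e ∈ (γ j i).support, e 0 ≤ L₁ ∧ e 1 ≤ L₂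

/-- The planar point of the pair `(S,(k₁,k₂))`: `Σ_i S_i • x_i + k₁ • d₁ + k₂ • d₂` (`= ptZ x d₁ S k₁ + k₂ • d₂`). -/
def pt2 (x : Fin n → Expo) (d₁ d₂ : Fin 2 → ℤ) (S : Fin n → ℕ) (k : ℕ × ℕ) : Fin 2 → ℤ :=
  fun c => ptZ x d₁ S k.1 c + (k.2 : ℤ) * d₂ c

/-- Live shallow pairs of the bi-tower model. -/
def live2 (γ γ' : Fin m → Fin n → MvPolynomial (Fin 2) ℂ) (m' : ℕ) : Set ((Fin n → ℕ) × (ℕ × ℕ)) :=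
  {p | size p.1 ≤ m' ∧ layer2 γ γ' p.2 p.1 ≠ 0}

/-- `(S,k)` is a RECORD for the real weight `ξ`: live and strictly heavier than every other live shallow pair. -/
def IsRecord2 (γ γ' : Fin m → Fin n → MvPolynomial (Fin 2) ℂ) (x : Fin n → Expo) (d₁ d₂ : Fin 2 → ℤ) (m' : ℕ)
    (ξ : Fin 2 → ℝ) (p : (Fin n → ℕ) × (ℕ × ℕ)) : Prop :=
  p ∈ live2 γ γ' m' ∧ ∀ q ∈ live2 γ γ' m', q ≠ p → wtZ ξ (pt2 x d₁ d₂ q.1 q.2) < wtZ ξ (pt2 x d₁ d₂ p.1 p.2)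

/-- The finite box of shallow pairs: entries of `S` at most `m'`, `k_c ≤ L_c m'`. -/
def shallowPairs2 (n m' L₁ L₂ : ℕ) : Finset ((Fin n → ℕ) × (ℕ × ℕ)) :=
  (Fintype.piFinset fun _ : Fin n => Finset.range (m' + 1)) ×ˢ (Finset.range (L₁ * m' + 1) ×ˢ Finset.range (L₂ * m' + 1))

/-- **R13²-box, coefficient side (claimed, paper proof only).**  Records of bi-towers with box `(L₁,L₂)` number
`≤ 2^{a m}(t+2)^b (L₁+1)(L₂+1)`. -/
def BiTowerRecordLaw : Prop :=
  ∃ a b : ℕ, ∀ (m n t L₁ L₂ : ℕ) (γ γ' : Fin m → Fin n → MvPolynomial (Fin 2) ℂ) (x : Fin n → Expo) (d₁ d₂ : Fin 2 → ℤ),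
    BidegLe γ L₁ L₂ → BidegLe γ' L₁ L₂ → n ≤ 2 * m * t →
    ((shallowPairs2 n m L₁ L₂).filter fun p => ∃ ξ : Fin 2 → ℝ, IsRecord2 γ γ' x d₁ d₂ m ξ p).card
      ≤ 2 ^ (a * m) * (t + 2) ^ b * (L₁ + 1) * (L₂ + 1)

/-- Bi-tower dissociation to depth `(m, L₁, L₂)`: shallow pairs are separated by their planar point. -/
def BiTowerDissociated (x : Fin n → Expo) (d₁ d₂ : Fin 2 → ℤ) (m L₁ L₂ : ℕ) : Prop :=
  ∀ (S S' : Fin n → ℕ) (k k' : ℕ × ℕ), size S ≤ m → size S' ≤ m →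
    k.1 ≤ L₁ * size S → k.2 ≤ L₂ * size S → k'.1 ≤ L₁ * size S' → k'.2 ≤ L₂ * size S' →
    pt2 x d₁ d₂ S k = pt2 x d₁ d₂ S' k' → (S = S' ∧ k = k')

/-- **R13²-box, class side (the rung in the ladder's currency; typed target).**  Instances whose tail alphabet lies in
`⋃_i x_i + [0,L₁]•d₁ + [0,L₂]•d₂`, bi-tower-dissociated to depth `(m,L₁,L₂)`, obey the per-cell law with the extra factor `(L₁+1)(L₂+1)`.
`L₂ = 0` is `TowerRecord.TowerCarrierLaw` with `D = L₁` (up to the vacuous second direction). -/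
def BiTowerCarrierLaw : Prop :=
  ∃ a b : ℕ, ∀ (m t n L₁ L₂ : ℕ) (u v : Fin m → MvPolynomial (Fin 2) ℂ) (x : Fin n → Expo) (d₁ d₂ : Fin 2 → ℤ),
    2 ≤ t →
    (∀ j, MvPolynomial.coeff 0 (u j) = 0 ∧ (u j).support.card ≤ t) →
    (∀ j, MvPolynomial.coeff 0 (v j) = 0 ∧ (v j).support.card ≤ t) →
    (∀ e ∈ tailSupport u v, ∃ i : Fin n, ∃ j₁ j₂ : ℕ, j₁ ≤ L₁ ∧ j₂ ≤ L₂ ∧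
        ∀ c, ((e c : ℕ) : ℤ) = ((x i c : ℕ) : ℤ) + (j₁ : ℤ) * d₁ c + (j₂ : ℤ) * d₂ c) →
    BiTowerDissociated x d₁ d₂ m L₁ L₂ →
    ∀ (R : Expo → Expo → Prop) (S : Finset Expo), IsCellFamily u v R S →
      S.card ≤ 2 ^ (a * m) * (t + 2) ^ b * (L₁ + 1) * (L₂ + 1)

/-- (A²) ⇒ (B²): the bidegree Lift (p3's degree-`D` Lift `TowerRecord.Lift.*` with `ℕ²` layers) — typed target, M-sized. -/
def biTowerCarrier_of_biTowerRecord : Prop := BiTowerRecordLaw → BiTowerCarrierLaw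

/-- Sanity: a record is unique per weight (so boundary rays of the comparison arrangement carry at most one record). -/
theorem record2_unique (γ γ' : Fin m → Fin n → MvPolynomial (Fin 2) ℂ) (x : Fin n → Expo) (d₁ d₂ : Fin 2 → ℤ) (m' : ℕ)
    (ξ : Fin 2 → ℝ) (p q : (Fin n → ℕ) × (ℕ × ℕ))
    (hp : IsRecord2 γ γ' x d₁ d₂ m' ξ p) (hq : IsRecord2 γ γ' x d₁ d₂ m' ξ q) : p = q := by
  by_contra hne
  have h1 := hp.2 q hq.1 (fun h => hne h.symm)
  have h2 := hq.2 p hp.1 hne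
  exact lt_irrefl _ (h1.trans h2)

end ValIdea34g9
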